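import Summits.CriticalPhenomena.PercolationContinuityZ3.Theorems.PercNearOneGluingNoHeavyLowerTailSunflowerLeafLeafDiagonal
import HarnessLib

/-!
# `NoHeavyLowerTail` (crux stmt-CriticalPhenomena-4575), abstract sunflower cubic: THE LEAF-LEAF LEMMA FROM A TWO-LEVEL LEMMA A
# (set level, no analytic relaxation): aligned and anti-aligned petals merge separately; the cross term is a mixed product

Support file (seat `prim-ineq-prove-1` gen 67; `--supports stmt-CriticalPhenomena-4575`).  No `sorry`, no named facts; one definition
(`TwoLevelLemmaA`, conjecture-shaped, used only as a hypothesis).  Memo: run/shared/lean/prim/prim-ineq-prove-1/FINDING-FREEFOUR-prove1-g67.md §7.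

SETTING (`…SunflowerLeafLeafDiagonal`).  `A' = A ∪ [z₁u] ∪ [z₁z₂] ∪ [z₂w]`; `z₂`-sections `C = A ∪ [z₁u]` (closed), `T = C ∪ [z₁] ∪ [w]` (open);
a petal `W ⊇ A'` has sections `L ⊆ U` with `C ⊆ L`, `T ⊆ U`, and two petals satisfy `L ∩ L' ⊆ C`, `U ∩ U' ⊆ T`, `L ∩ U' ⊆ T`;
`μ(W) = t·μ(U) + (1−t)·μ(L)`, `μ(A') = t·a + (1−t)·g` (`a = μ(T)`, `g = μ(C)`).  A petal is ALIGNED when `g·μ(U) ≤ a·μ(L)` (every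
`z₂`-diagonal petal is, `leafLeaf_diagonal`) and ANTI-ALIGNED otherwise.  THE OBSERVATION: aligned petals merge among themselves
(`aligned_merge_prod_le`) AND SO DO ANTI-ALIGNED ONES (`antialigned_merge_prod_le`, same identity, the two deviations having the same sign);
so every family is bounded by `F^(n−2)` times a product of TWO virtual two-coin factors `(tÛ_Q+(1−t)L̂_Q)(tÛ_P+(1−t)L̂_P)`, and of the
four coefficients of that product three are controlled by `T`-safety, `C`-safety and the anti-alignment of the merged `P`; the remaining
one, `L̂_Q·Û_P ≤ a`, is EXACTLY a mixed-product statement: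
* `TwoLevelLemmaA p C T` — for up-sets `L_j ⊇ C` (`j ∈ Q ≠ ∅`) pairwise meeting in `C` and `U_i ⊇ T` (`i ∈ P`) pairwise meeting in `T`,
  with `L_j ∩ U_i ⊆ T`:  `∏_Q μ(L_j) · ∏_P μ(U_i) ≤ μ(C)^(|Q|−1) · μ(T)^|P|`  (the spanning-tree bound; `P = ∅` is `C`-safety, `|Q| = 1`
  is `T`-safety, `U_i = univ` is the relative Lemma A `relLemmaA_pendant`; numerically true on all small cores tested, memo §7; OPEN);
* `antialigned_merge_prod_le`;
* **`leafLeaf_of_twoLevel`** (fixed `p`): `C` and `delMinor w A` safe, `μ(delMinor w A) > 0`, `TwoLevelLemmaA p C T` ⟹ Lemma A for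
  EVERY family of up-sets meeting pairwise inside `A'`;  `leafLeaf_of_twoLevel_aSafe` (from A-safety of `A`).
So the general leaf-leaf lemma (hence `LeafLeafSafe`) follows from the two-level Lemma A for the pair `(A ∪ [z₁u], A ∪ [z₁u] ∪ [z₁] ∪ [w])`,
with no exchange argument and no cell budgets.
-/

noncomputable section

namespace Summit.CriticalPhenomena.PercolationContinuityZ3.Theorems.SunflowerPartition

namespace SafeCalc

open MeasureTheory Finset
open Literature.Probability.LatticeModels Literature.Probability.Percolation

namespace LeafLeafZ

variable {κ : Type*}

/-- **Anti-aligned two-coin factors merge as well**: `g·A_i ≥ a·ψ_i` for all `i ∈ S` gives the same bound as `aligned_merge_prod_le`.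
[this work] -/
theorem antialigned_merge_prod_le [DecidableEq κ] {t a g : ℝ} (ht0 : 0 ≤ t) (ht1 : t ≤ 1) (ha : 0 < a) (hg : 0 < g) (S : Finset κ)
    (hS : S.Nonempty) (A ψ : κ → ℝ) (hA : ∀ i ∈ S, 0 ≤ A i) (hψ : ∀ i ∈ S, 0 ≤ ψ i) (hal : ∀ i ∈ S, a * ψ i ≤ g * A i) :
    ∏ i ∈ S, (t * A i + (1 - t) * ψ i) ≤
      (t * a + (1 - t) * g) ^ (S.card - 1) * (t * ((∏ i ∈ S, A i) / a ^ (S.card - 1)) + (1 - t) * ((∏ i ∈ S, ψ i) / g ^ (S.card - 1))) := by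
  classical
  induction S using Finset.induction_on with
  | empty => exact absurd hS (by simp)
  | @insert j S hj ih =>
    rcases S.eq_empty_or_nonempty with rfl | hSne
    · simp
    · have hA' : ∀ i ∈ S, 0 ≤ A i := fun i hi => hA i (mem_insert_of_mem hi)
      have hψ' : ∀ i ∈ S, 0 ≤ ψ i := fun i hi => hψ i (mem_insert_of_mem hi)
      have hal' : ∀ i ∈ S, a * ψ i ≤ g * A i := fun i hi => hal i (mem_insert_of_mem hi)
      have ih' := ih hSne hA' hψ' hal'
      have hAj : 0 ≤ A j := hA j (mem_insert_self j S)
      have hψj : 0 ≤ ψ j := hψ j (mem_insert_self j S)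
      have halj : a * ψ j ≤ g * A j := hal j (mem_insert_self j S)
      have ht' : 0 ≤ 1 - t := sub_nonneg.2 ht1
      have hF : 0 ≤ t * a + (1 - t) * g := add_nonneg (mul_nonneg ht0 ha.le) (mul_nonneg ht' hg.le)
      have hFj : 0 ≤ t * A j + (1 - t) * ψ j := add_nonneg (mul_nonneg ht0 hAj) (mul_nonneg ht' hψj)
      set PA : ℝ := (∏ i ∈ S, A i) / a ^ (S.card - 1) with hPA
      set Pψ : ℝ := (∏ i ∈ S, ψ i) / g ^ (S.card - 1) with hPψ
      have hcard : S.card = S.card - 1 + 1 := (Nat.sub_add_cancel (card_pos.2 hSne)).symm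
      have hprodal : a ^ S.card * ∏ i ∈ S, ψ i ≤ g ^ S.card * ∏ i ∈ S, A i := by
        rw [← prod_const, ← prod_const, ← prod_mul_distrib, ← prod_mul_distrib]
        exact prod_le_prod (fun i hi => mul_nonneg ha.le (hψ' i hi)) fun i hi => hal' i hi
      have halP : a * Pψ ≤ g * PA := by
        rw [hPA, hPψ, mul_div_assoc', mul_div_assoc', div_le_div_iff₀ (pow_pos hg _) (pow_pos ha _)]
        have e1 : a * (∏ i ∈ S, ψ i) * a ^ (S.card - 1) = a ^ S.card * ∏ i ∈ S, ψ i := by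
          conv_rhs => rw [hcard, pow_succ]
          ring
        have e2 : g * (∏ i ∈ S, A i) * g ^ (S.card - 1) = g ^ S.card * ∏ i ∈ S, A i := by
          conv_rhs => rw [hcard, pow_succ]
          ring
        rw [e1, e2]; exact hprodal
      have hmerge : (t * A j + (1 - t) * ψ j) * (t * PA + (1 - t) * Pψ) ≤
          (t * a + (1 - t) * g) * (t * (A j * PA / a) + (1 - t) * (ψ j * Pψ / g)) := by
        rw [← sub_nonneg]
        have key : (t * a + (1 - t) * g) * (t * (A j * PA / a) + (1 - t) * (ψ j * Pψ / g)) -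
            (t * A j + (1 - t) * ψ j) * (t * PA + (1 - t) * Pψ) = t * (1 - t) * ((a * ψ j - g * A j) * (a * Pψ - g * PA) / (a * g)) := by
          field_simp
          ring
        rw [key]
        exact mul_nonneg (mul_nonneg ht0 ht')
          (div_nonneg (mul_nonneg_of_nonpos_of_nonpos (sub_nonpos.2 halj) (sub_nonpos.2 halP)) (mul_pos ha hg).le)
      have hcard2 : (insert j S).card - 1 = S.card := by rw [card_insert_of_notMem hj]; simp
      have hFpow : (t * a + (1 - t) * g) ^ S.card = (t * a + (1 - t) * g) ^ (S.card - 1) * (t * a + (1 - t) * g) := by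
        conv_lhs => rw [hcard, pow_succ]
      have hap : a ^ S.card = a ^ (S.card - 1) * a := by conv_lhs => rw [hcard, pow_succ]
      have hgp : g ^ S.card = g ^ (S.card - 1) * g := by conv_lhs => rw [hcard, pow_succ]
      have eA : A j * PA / a = (A j * ∏ i ∈ S, A i) / a ^ S.card := by
        rw [hPA, hap]; field_simp
      have eψ : ψ j * Pψ / g = (ψ j * ∏ i ∈ S, ψ i) / g ^ S.card := by
        rw [hPψ, hgp]; field_simp
      rw [prod_insert hj, prod_insert hj, prod_insert hj, hcard2]
      calc (t * A j + (1 - t) * ψ j) * ∏ i ∈ S, (t * A i + (1 - t) * ψ i)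
          ≤ (t * A j + (1 - t) * ψ j) * ((t * a + (1 - t) * g) ^ (S.card - 1) * (t * PA + (1 - t) * Pψ)) :=
            mul_le_mul_of_nonneg_left ih' hFj
        _ = (t * a + (1 - t) * g) ^ (S.card - 1) * ((t * A j + (1 - t) * ψ j) * (t * PA + (1 - t) * Pψ)) := by ring
        _ ≤ (t * a + (1 - t) * g) ^ (S.card - 1) * ((t * a + (1 - t) * g) * (t * (A j * PA / a) + (1 - t) * (ψ j * Pψ / g))) :=
            mul_le_mul_of_nonneg_left hmerge (pow_nonneg hF _)
        _ = (t * a + (1 - t) * g) ^ S.card * (t * ((A j * ∏ i ∈ S, A i) / a ^ S.card) + (1 - t) * ((ψ j * ∏ i ∈ S, ψ i) / g ^ S.card)) := by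
            rw [eA, eψ, hFpow]; ring

end LeafLeafZ

open RelLemmaA UnionEdge LeafLeafZ

variable {ι : Type*} [Fintype ι] [DecidableEq ι] (p : ι → unitInterval)

/-- **`TwoLevelLemmaA p C T` (statement)**: the spanning-tree Lemma A for the two-level core `C ⊆ T` — for a nonempty finite family of
up-sets `L_j ⊇ C` pairwise meeting in `C` and a finite family of up-sets `U_i ⊇ T` pairwise meeting in `T`, with `L_j ∩ U_i ⊆ T` for all
`j, i`:  `∏ μ(L_j) · ∏ μ(U_i) ≤ μ(C)^(|Q|−1) · μ(T)^|P|`.  Stated with both families indexed inside one `Fin n` by disjoint finsets `Q`, `P`.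
Open (meant for `C = A ∪ [z₁u]`, `T = C ∪ [z₁] ∪ [w]`; memo §7). [conjecture-shaped hypothesis, this work] -/
def TwoLevelLemmaA (p : ι → unitInterval) (C T : Set (Set ι)) : Prop :=
  ∀ (n : ℕ) (L U : Fin n → Set (Set ι)) (Q P : Finset (Fin n)), Q.Nonempty → Disjoint Q P →
    (∀ j ∈ Q, IsUpperSet (L j)) → (∀ j ∈ Q, C ⊆ L j) → (∀ i ∈ P, IsUpperSet (U i)) → (∀ i ∈ P, T ⊆ U i) →
    (∀ j ∈ Q, ∀ j' ∈ Q, j ≠ j' → L j ∩ L j' ⊆ C) → (∀ i ∈ P, ∀ i' ∈ P, i ≠ i' → U i ∩ U i' ⊆ T) →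
    (∀ j ∈ Q, ∀ i ∈ P, L j ∩ U i ⊆ T) →
    (∏ j ∈ Q, (prodBernoulli p).real (L j)) * ∏ i ∈ P, (prodBernoulli p).real (U i) ≤
      (prodBernoulli p).real C ^ (Q.card - 1) * (prodBernoulli p).real T ^ P.card

set_option maxHeartbeats 400000 in
/-- **THE LEAF-LEAF LEMMA FROM THE TWO-LEVEL LEMMA A (fixed `p`), every family.**  `A` an up-set not depending on `z₁, z₂`; `z₁, z₂, u, w`
pairwise distinct; `C = A ∪ [z₁u]` and `delMinor w A` safe at `p`, `μ(delMinor w A) > 0`; `TwoLevelLemmaA p C T` with `T = C ∪ [z₁] ∪ [w]`.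
Then every family of up-sets meeting pairwise inside `A'` satisfies `∏ μ(V_i) ≤ μ(A')^(n−1)`. [this work] -/
theorem leafLeaf_of_twoLevel {z₁ z₂ u w : ι} (h12 : z₁ ≠ z₂) (h1w : z₁ ≠ w) (h2u : z₂ ≠ u) (h2w : z₂ ≠ w)
    {A : Set (Set ι)} (hd₁ : DeterminedBy A (↑({z₁} : Finset ι) : Set ι)ᶜ)
    (hd₂ : DeterminedBy A (↑({z₂} : Finset ι) : Set ι)ᶜ) (hA : IsUpperSet A)
    (hC : Safe p (A ∪ pairOpen z₁ u)) (hAw : Safe p (delMinor w A)) (hpos : 0 < (prodBernoulli p).real (delMinor w A))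
    (hTL : TwoLevelLemmaA p (A ∪ pairOpen z₁ u) (A ∪ pairOpen z₁ u ∪ ({ω | z₁ ∈ ω} ∪ {ω | w ∈ ω})))
    {n : ℕ} (V : Fin n → Set (Set ι)) (hV : ∀ i, IsUpperSet (V i))
    (hcap : ∀ i j, i ≠ j → V i ∩ V j ⊆ A ∪ pairOpen z₁ u ∪ (pairOpen z₁ z₂ ∪ pairOpen z₂ w)) :
    ∏ i, (prodBernoulli p).real (V i) ≤
      (prodBernoulli p).real (A ∪ pairOpen z₁ u ∪ (pairOpen z₁ z₂ ∪ pairOpen z₂ w)) ^ (n - 1) := by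
  classical
  rcases Nat.eq_zero_or_pos n with rfl | hn
  · simp
  set A' : Set (Set ι) := A ∪ pairOpen z₁ u ∪ (pairOpen z₁ z₂ ∪ pairOpen z₂ w) with hA'def
  set C : Set (Set ι) := A ∪ pairOpen z₁ u with hCdef
  set T : Set (Set ι) := A ∪ pairOpen z₁ u ∪ ({ω | z₁ ∈ ω} ∪ {ω | w ∈ ω}) with hTdef
  have hz₁up : IsUpperSet {ω : Set ι | z₁ ∈ ω} := fun _ _ hle h => hle h
  have hwup : IsUpperSet {ω : Set ι | w ∈ ω} := fun _ _ hle h => hle h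
  have hCup : IsUpperSet C := hA.union (isUpperSet_pairOpen z₁ u)
  have hA'up : IsUpperSet A' := hCup.union ((isUpperSet_pairOpen z₁ z₂).union (isUpperSet_pairOpen z₂ w))
  have hCT : C ⊆ T := Set.subset_union_left
  -- sections of `A'` at `z₂`
  have hA'_on : secOn z₂ A' = T := by
    rw [hA'def, secOn_union, secOn_union, secOn_union, secOn_eq_self_of_determinedBy hd₂, secOn_pairOpen_of_ne h12 h2u.symm,
      secOn_pairOpen_right h12, secOn_pairOpen_left h2w]
  have hA'_off : secOff z₂ A' = C := by
    rw [hA'def, secOff_union, secOff_union, secOff_union, secOff_eq_self_of_determinedBy hd₂,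
      secOff_pairOpen_of_ne h12 h2u.symm, secOff_pairOpen_right, secOff_pairOpen_left, Set.union_empty, Set.union_empty]
  -- `T` is safe
  have hTeq : T = (A ∪ {ω | w ∈ ω}) ∪ {ω | z₁ ∈ ω} := by
    ext ω
    simp only [hTdef, pairOpen, Set.mem_union, Set.mem_setOf_eq]
    tauto
  have hA1up : IsUpperSet (A ∪ {ω : Set ι | w ∈ ω}) := hA.union hwup
  have hA1_off : secOff z₁ (A ∪ {ω : Set ι | w ∈ ω}) = A ∪ {ω | w ∈ ω} := by
    rw [secOff_union, secOff_eq_self_of_determinedBy hd₁, secOff_setOf_mem_of_ne h1w.symm]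
  have hA1safe : Safe p (A ∪ {ω : Set ι | w ∈ ω}) := safe_union_open p w hA hAw hpos
  have hA1pos : 0 < (prodBernoulli p).real (delMinor z₁ (A ∪ {ω : Set ι | w ∈ ω})) := by
    rw [show delMinor z₁ (A ∪ {ω : Set ι | w ∈ ω}) = secOff z₁ (A ∪ {ω | w ∈ ω}) from rfl, hA1_off]
    exact hpos.trans_le (measureReal_mono ((delMinor_subset w hA).trans Set.subset_union_left))
  have hTsafe : Safe p T := by
    rw [hTeq]
    refine safe_union_open p z₁ hA1up ?_ hA1pos
    rw [show delMinor z₁ (A ∪ {ω : Set ι | w ∈ ω}) = secOff z₁ (A ∪ {ω | w ∈ ω}) from rfl, hA1_off]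
    exact hA1safe
  -- enlarge the petals; sections
  set W : Fin n → Set (Set ι) := fun i => V i ∪ A' with hW
  have hWup : ∀ i, IsUpperSet (W i) := fun i => (hV i).union hA'up
  have hWA : ∀ i, A' ⊆ W i := fun i => Set.subset_union_right
  have hWcap : ∀ i j, i ≠ j → W i ∩ W j ⊆ A' := by
    intro i j hij ω hω
    rcases hω with ⟨h1 | h1, h2 | h2⟩
    · exact hcap i j hij ⟨h1, h2⟩
    exacts [h2, h1, h1]
  have hmono : ∀ i, (prodBernoulli p).real (V i) ≤ (prodBernoulli p).real (W i) := fun i => measureReal_mono Set.subset_union_left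
  set L : Fin n → Set (Set ι) := fun i => secOff z₂ (W i) with hL
  set U : Fin n → Set (Set ι) := fun i => secOn z₂ (W i) with hU
  have hLup : ∀ i, IsUpperSet (L i) := fun i => isUpperSet_secOff z₂ (hWup i)
  have hUup : ∀ i, IsUpperSet (U i) := fun i => isUpperSet_secOn z₂ (hWup i)
  have hLC : ∀ i, C ⊆ L i := fun i => by rw [← hA'_off]; exact secOff_mono z₂ (hWA i)
  have hUT : ∀ i, T ⊆ U i := fun i => by rw [← hA'_on]; exact secOn_mono z₂ (hWA i)
  have hLU : ∀ i, L i ⊆ U i := fun i => secOff_subset_secOn z₂ (hWup i)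
  have hLcap : ∀ i j, i ≠ j → L i ∩ L j ⊆ C := fun i j hij => by
    simp only [hL]; rw [← secOff_inter, ← hA'_off]; exact secOff_mono z₂ (hWcap i j hij)
  have hUcap : ∀ i j, i ≠ j → U i ∩ U j ⊆ T := fun i j hij => by
    simp only [hU]; rw [← secOn_inter, ← hA'_on]; exact secOn_mono z₂ (hWcap i j hij)
  have hLUcap : ∀ i j, i ≠ j → L i ∩ U j ⊆ T := fun i j hij =>
    (Set.inter_subset_inter_left _ (hLU i)).trans (hUcap i j hij)
  -- numbers
  set t : ℝ := ((p z₂ : unitInterval) : ℝ) with ht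
  have ht0 : 0 ≤ t := (p z₂).2.1
  have ht1 : t ≤ 1 := (p z₂).2.2
  have ht' : 0 ≤ 1 - t := sub_nonneg.2 ht1
  set g : ℝ := (prodBernoulli p).real C with hgdef
  set a : ℝ := (prodBernoulli p).real T with hadef
  have hga : g ≤ a := measureReal_mono hCT
  have hgpos : 0 < g := by
    refine hpos.trans_le (measureReal_mono ?_)
    exact (delMinor_subset w hA).trans Set.subset_union_left
  have hapos : 0 < a := hgpos.trans_le hga
  set Av : Fin n → ℝ := fun i => (prodBernoulli p).real (U i) with hAv
  set ψv : Fin n → ℝ := fun i => (prodBernoulli p).real (L i) with hψv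
  have hAv0 : ∀ i, 0 ≤ Av i := fun i => measureReal_nonneg
  have hψv0 : ∀ i, 0 ≤ ψv i := fun i => measureReal_nonneg
  have hA'val : (prodBernoulli p).real A' = t * a + (1 - t) * g := by
    rw [real_eq_secOn_secOff p z₂ A', hA'_on, hA'_off]
  have hWval : ∀ i, (prodBernoulli p).real (W i) = t * Av i + (1 - t) * ψv i := by
    intro i; rw [real_eq_secOn_secOff p z₂ (W i)]
  have hF0 : 0 ≤ t * a + (1 - t) * g := add_nonneg (mul_nonneg ht0 hapos.le) (mul_nonneg ht' hgpos.le)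
  -- budgets on any sub-finset
  have hBψS : ∀ S : Finset (Fin n), ∏ i ∈ S, ψv i ≤ g ^ (S.card - 1) := by
    intro S
    have h1 := hC.prod_le (κ := S) (V := fun i : S => L i) (fun i => hLup i)
      (fun i j hij => hLcap i j fun h => hij (Subtype.ext h))
    rw [Fintype.card_coe] at h1
    rw [← prod_coe_sort S]; exact h1
  have hBAS : ∀ S : Finset (Fin n), ∏ i ∈ S, Av i ≤ a ^ (S.card - 1) := by
    intro S
    have h1 := hTsafe.prod_le (κ := S) (V := fun i : S => U i) (fun i => hUup i)
      (fun i j hij => hUcap i j fun h => hij (Subtype.ext h))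
    rw [Fintype.card_coe] at h1
    rw [← prod_coe_sort S]; exact h1
  rw [hA'val]
  refine (prod_le_prod (fun i _ => measureReal_nonneg) fun i _ => hmono i).trans ?_
  rw [prod_congr rfl fun i _ => hWval i]
  -- split into aligned and anti-aligned petals
  set Q : Finset (Fin n) := univ.filter fun i => g * Av i ≤ a * ψv i with hQ
  set P : Finset (Fin n) := univ.filter fun i => ¬ g * Av i ≤ a * ψv i with hP
  have hQal : ∀ i ∈ Q, g * Av i ≤ a * ψv i := fun i hi => (mem_filter.1 hi).2
  have hPal : ∀ i ∈ P, a * ψv i ≤ g * Av i := fun i hi => (le_of_lt (not_le.1 (mem_filter.1 hi).2))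
  have hsplit : ∏ i, (t * Av i + (1 - t) * ψv i) =
      (∏ i ∈ Q, (t * Av i + (1 - t) * ψv i)) * ∏ i ∈ P, (t * Av i + (1 - t) * ψv i) :=
    (prod_filter_mul_prod_filter_not univ _ _).symm
  have hcardQP : Q.card + P.card = n := by
    have := Finset.card_filter_add_card_filter_not (s := (univ : Finset (Fin n))) (fun i => g * Av i ≤ a * ψv i)
    rw [card_univ, Fintype.card_fin] at this; exact this
  have hdisj : Disjoint Q P := by
    rw [hQ, hP]; exact disjoint_filter_filter_not univ univ _
  rw [hsplit]
  rcases P.eq_empty_or_nonempty with hPe | hPne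
  · -- everything aligned
    rw [hPe, prod_empty, mul_one]
    have hQu : Q = univ := by
      have := hcardQP; rw [hPe, card_empty, add_zero] at this
      exact eq_univ_of_card Q (by rw [this, Fintype.card_fin])
    rw [hQu]
    have hne : (univ : Finset (Fin n)).Nonempty := ⟨⟨0, hn⟩, mem_univ _⟩
    have key := interp_prod_le ht0 ht1 hapos hgpos univ hne Av ψv (fun i _ => hAv0 i) (fun i _ => hψv0 i)
      (fun i hi => hQal i (hQu ▸ hi)) (hBAS univ) (hBψS univ)
    rw [card_univ, Fintype.card_fin] at key; exact key
  rcases Q.eq_empty_or_nonempty with hQe | hQne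
  · -- everything anti-aligned
    rw [hQe, prod_empty, one_mul]
    have hPu : P = univ := by
      have := hcardQP; rw [hQe, card_empty, zero_add] at this
      exact eq_univ_of_card P (by rw [this, Fintype.card_fin])
    rw [hPu]
    have hne : (univ : Finset (Fin n)).Nonempty := ⟨⟨0, hn⟩, mem_univ _⟩
    have key := antialigned_merge_prod_le ht0 ht1 hapos hgpos univ hne Av ψv (fun i _ => hAv0 i) (fun i _ => hψv0 i)
      (fun i hi => hPal i (hPu ▸ hi))
    rw [card_univ, Fintype.card_fin] at key
    have h1 : (∏ i, Av i) / a ^ (n - 1) ≤ 1 := by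
      rw [div_le_one (pow_pos hapos _)]; have := hBAS univ; rwa [card_univ, Fintype.card_fin] at this
    have h2 : (∏ i, ψv i) / g ^ (n - 1) ≤ 1 := by
      rw [div_le_one (pow_pos hgpos _)]; have := hBψS univ; rwa [card_univ, Fintype.card_fin] at this
    refine key.trans ?_
    have h3 : t * ((∏ i, Av i) / a ^ (n - 1)) + (1 - t) * ((∏ i, ψv i) / g ^ (n - 1)) ≤ 1 := by
      nlinarith [mul_le_mul_of_nonneg_left h1 ht0, mul_le_mul_of_nonneg_left h2 ht']
    calc (t * a + (1 - t) * g) ^ (n - 1) * (t * ((∏ i, Av i) / a ^ (n - 1)) + (1 - t) * ((∏ i, ψv i) / g ^ (n - 1)))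
        ≤ (t * a + (1 - t) * g) ^ (n - 1) * 1 := mul_le_mul_of_nonneg_left h3 (pow_nonneg hF0 _)
      _ = _ := mul_one _
  -- both classes present: merge each and bound the two-body product coefficientwise
  have hQ1 : 1 ≤ Q.card := card_pos.2 hQne
  have hP1 : 1 ≤ P.card := card_pos.2 hPne
  have mQ := aligned_merge_prod_le ht0 ht1 hapos hgpos Q hQne Av ψv (fun i _ => hAv0 i) (fun i _ => hψv0 i) hQal
  have mP := antialigned_merge_prod_le ht0 ht1 hapos hgpos P hPne Av ψv (fun i _ => hAv0 i) (fun i _ => hψv0 i) hPal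
  set UQ : ℝ := (∏ i ∈ Q, Av i) / a ^ (Q.card - 1) with hUQ
  set LQ : ℝ := (∏ i ∈ Q, ψv i) / g ^ (Q.card - 1) with hLQ
  set UP : ℝ := (∏ i ∈ P, Av i) / a ^ (P.card - 1) with hUP
  set LP : ℝ := (∏ i ∈ P, ψv i) / g ^ (P.card - 1) with hLP
  have hPQA0 : 0 ≤ ∏ i ∈ Q, Av i := prod_nonneg fun i _ => hAv0 i
  have hPPA0 : 0 ≤ ∏ i ∈ P, Av i := prod_nonneg fun i _ => hAv0 i
  have hPQψ0 : 0 ≤ ∏ i ∈ Q, ψv i := prod_nonneg fun i _ => hψv0 i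
  have hPPψ0 : 0 ≤ ∏ i ∈ P, ψv i := prod_nonneg fun i _ => hψv0 i
  have hUQ0 : 0 ≤ UQ := div_nonneg hPQA0 (pow_nonneg hapos.le _)
  have hUP0 : 0 ≤ UP := div_nonneg hPPA0 (pow_nonneg hapos.le _)
  have haQ : 0 < a ^ (Q.card - 1) := pow_pos hapos _
  have haP : 0 < a ^ (P.card - 1) := pow_pos hapos _
  have hgQ : 0 < g ^ (Q.card - 1) := pow_pos hgpos _
  have hgP : 0 < g ^ (P.card - 1) := pow_pos hgpos _
  have hpowa : a ^ (n - 1) = a ^ (Q.card - 1) * a ^ (P.card - 1) * a := by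
    rw [← pow_add, ← pow_succ]; congr 1; omega
  have hpowg : g ^ (n - 1) = g ^ (Q.card - 1) * g ^ (P.card - 1) * g := by
    rw [← pow_add, ← pow_succ]; congr 1; omega
  -- (i) `UQ·UP ≤ a` and (ii) `LQ·LP ≤ g`
  have hprodA : (∏ i ∈ Q, Av i) * ∏ i ∈ P, Av i ≤ a ^ (n - 1) := by
    rw [prod_filter_mul_prod_filter_not univ]; have := hBAS univ; rwa [card_univ, Fintype.card_fin] at this
  have hprodψ : (∏ i ∈ Q, ψv i) * ∏ i ∈ P, ψv i ≤ g ^ (n - 1) := by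
    rw [prod_filter_mul_prod_filter_not univ]; have := hBψS univ; rwa [card_univ, Fintype.card_fin] at this
  have hT2 : UQ * UP ≤ a := by
    rw [hUQ, hUP, div_mul_div_comm, div_le_iff₀ (mul_pos haQ haP)]
    calc (∏ i ∈ Q, Av i) * ∏ i ∈ P, Av i ≤ a ^ (n - 1) := hprodA
      _ = a * (a ^ (Q.card - 1) * a ^ (P.card - 1)) := by rw [hpowa]; ring
  have hC2 : LQ * LP ≤ g := by
    rw [hLQ, hLP, div_mul_div_comm, div_le_iff₀ (mul_pos hgQ hgP)]
    calc (∏ i ∈ Q, ψv i) * ∏ i ∈ P, ψv i ≤ g ^ (n - 1) := hprodψ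
      _ = g * (g ^ (Q.card - 1) * g ^ (P.card - 1)) := by rw [hpowg]; ring
  -- (iii) the merged `P` is anti-aligned: `a·LP ≤ g·UP`, hence `UQ·LP ≤ g`
  have hPcard : P.card = P.card - 1 + 1 := (Nat.sub_add_cancel hP1).symm
  have hantiP : a * LP ≤ g * UP := by
    have hprodal : a ^ P.card * ∏ i ∈ P, ψv i ≤ g ^ P.card * ∏ i ∈ P, Av i := by
      rw [← prod_const, ← prod_const, ← prod_mul_distrib, ← prod_mul_distrib]
      exact prod_le_prod (fun i hi => mul_nonneg hapos.le (hψv0 i)) fun i hi => hPal i hi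
    rw [hLP, hUP, mul_div_assoc', mul_div_assoc', div_le_div_iff₀ hgP haP]
    have e1 : a * (∏ i ∈ P, ψv i) * a ^ (P.card - 1) = a ^ P.card * ∏ i ∈ P, ψv i := by
      conv_rhs => rw [hPcard, pow_succ]
      ring
    have e2 : g * (∏ i ∈ P, Av i) * g ^ (P.card - 1) = g ^ P.card * ∏ i ∈ P, Av i := by
      conv_rhs => rw [hPcard, pow_succ]
      ring
    rw [e1, e2]; exact hprodal
  have hX1 : UQ * LP ≤ g := by
    have h1 : a * (UQ * LP) ≤ g * (UQ * UP) := by nlinarith [mul_le_mul_of_nonneg_left hantiP hUQ0]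
    have h2 : g * (UQ * UP) ≤ g * a := mul_le_mul_of_nonneg_left hT2 hgpos.le
    nlinarith
  -- (iv) the mixed product: the two-level Lemma A
  have hX2 : LQ * UP ≤ a := by
    have key := hTL n L U Q P hQne hdisj (fun j _ => hLup j) (fun j _ => hLC j) (fun i _ => hUup i) (fun i _ => hUT i)
      (fun j _ j' _ hjj => hLcap j j' hjj) (fun i _ i' _ hii => hUcap i i' hii)
      (fun j hj i hi => hLUcap j i fun h => (disjoint_left.1 hdisj hj) (h ▸ hi))
    rw [hLQ, hUP, div_mul_div_comm, div_le_iff₀ (mul_pos hgQ haP)]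
    have haPs : a ^ P.card = a * a ^ (P.card - 1) := by rw [← pow_succ']; congr 1
    calc (∏ i ∈ Q, ψv i) * ∏ i ∈ P, Av i ≤ g ^ (Q.card - 1) * a ^ P.card := key
      _ = a * (g ^ (Q.card - 1) * a ^ (P.card - 1)) := by rw [haPs]; ring
  -- the two-body bound
  have two : (t * UQ + (1 - t) * LQ) * (t * UP + (1 - t) * LP) ≤ t * a + (1 - t) * g := by
    have k1 := mul_le_mul_of_nonneg_left hT2 (mul_nonneg ht0 ht0)
    have k2 := mul_le_mul_of_nonneg_left hC2 (mul_nonneg ht' ht')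
    have k3 := mul_le_mul_of_nonneg_left (add_le_add hX1 hX2) (mul_nonneg ht0 ht')
    have e1 : (t * UQ + (1 - t) * LQ) * (t * UP + (1 - t) * LP) =
        t * t * (UQ * UP) + (1 - t) * (1 - t) * (LQ * LP) + t * (1 - t) * (UQ * LP + LQ * UP) := by ring
    have e2 : t * a + (1 - t) * g = t * t * a + (1 - t) * (1 - t) * g + t * (1 - t) * (g + a) := by ring
    rw [e1, e2]; linarith
  have hfacQ : 0 ≤ t * UQ + (1 - t) * LQ := add_nonneg (mul_nonneg ht0 hUQ0) (mul_nonneg ht' (div_nonneg hPQψ0 (pow_nonneg hgpos.le _)))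
  have hpowF : (t * a + (1 - t) * g) ^ (n - 1) =
      (t * a + (1 - t) * g) ^ (Q.card - 1) * (t * a + (1 - t) * g) ^ (P.card - 1) * (t * a + (1 - t) * g) := by
    rw [← pow_add, ← pow_succ]; congr 1; omega
  calc (∏ i ∈ Q, (t * Av i + (1 - t) * ψv i)) * ∏ i ∈ P, (t * Av i + (1 - t) * ψv i)
      ≤ ((t * a + (1 - t) * g) ^ (Q.card - 1) * (t * UQ + (1 - t) * LQ)) *
          ((t * a + (1 - t) * g) ^ (P.card - 1) * (t * UP + (1 - t) * LP)) :=
        mul_le_mul mQ mP (prod_nonneg fun i _ => add_nonneg (mul_nonneg ht0 (hAv0 i)) (mul_nonneg ht' (hψv0 i)))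
          (mul_nonneg (pow_nonneg hF0 _) hfacQ)
    _ = (t * a + (1 - t) * g) ^ (Q.card - 1) * (t * a + (1 - t) * g) ^ (P.card - 1) *
          ((t * UQ + (1 - t) * LQ) * (t * UP + (1 - t) * LP)) := by ring
    _ ≤ (t * a + (1 - t) * g) ^ (Q.card - 1) * (t * a + (1 - t) * g) ^ (P.card - 1) * (t * a + (1 - t) * g) :=
        mul_le_mul_of_nonneg_left two (mul_nonneg (pow_nonneg hF0 _) (pow_nonneg hF0 _))
    _ = (t * a + (1 - t) * g) ^ (n - 1) := hpowF.symm

/-- **The leaf-leaf lemma from the two-level Lemma A and A-safety of `A`** (+ positivity): the safety of `A ∪ {z₁,u open}` is the pendant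
theorem, that of `delMinor w A` is `aSafe_delMinor`. [this work] -/
theorem leafLeaf_of_twoLevel_aSafe {z₁ z₂ u w : ι} (h12 : z₁ ≠ z₂) (h1u : z₁ ≠ u) (h1w : z₁ ≠ w) (h2u : z₂ ≠ u) (h2w : z₂ ≠ w)
    {A : Set (Set ι)} (hd₁ : DeterminedBy A (↑({z₁} : Finset ι) : Set ι)ᶜ)
    (hd₂ : DeterminedBy A (↑({z₂} : Finset ι) : Set ι)ᶜ) (hA : IsUpperSet A) (hsafe : ∀ q, Safe q A)
    (hpos : 0 < (prodBernoulli p).real (delMinor w A))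
    (hTL : TwoLevelLemmaA p (A ∪ pairOpen z₁ u) (A ∪ pairOpen z₁ u ∪ ({ω | z₁ ∈ ω} ∪ {ω | w ∈ ω})))
    {n : ℕ} (V : Fin n → Set (Set ι)) (hV : ∀ i, IsUpperSet (V i))
    (hcap : ∀ i j, i ≠ j → V i ∩ V j ⊆ A ∪ pairOpen z₁ u ∪ (pairOpen z₁ z₂ ∪ pairOpen z₂ w)) :
    ∏ i, (prodBernoulli p).real (V i) ≤
      (prodBernoulli p).real (A ∪ pairOpen z₁ u ∪ (pairOpen z₁ z₂ ∪ pairOpen z₂ w)) ^ (n - 1) := by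
  have hC : Safe p (A ∪ pairOpen z₁ u) := by
    rw [pairOpen_comm]
    exact Pendant.safe_union_pendant p h1u.symm hd₁ hA (hsafe p) (aSafe_delMinor hA hsafe u p) (aSafe_conMinor hA hsafe u p)
  exact leafLeaf_of_twoLevel p h12 h1w h2u h2w hd₁ hd₂ hA hC (aSafe_delMinor hA hsafe w p) hpos hTL V hV hcap

end SafeCalc

end Summit.CriticalPhenomena.PercolationContinuityZ3.Theorems.SunflowerPartition
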